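import Mathlib
import Summits.ResolutionOfSingularities.ResolutionOfSingularities.Theorems.WeightedInvariantLocalWeightedDropTOT2BridgePresentedStepGraph
import Summits.ResolutionOfSingularities.ResolutionOfSingularities.Theorems.WeightedInvariantLocalWeightedDropNCResPresentationDefs

/-!
# TOT2-LINE v1.3, regime (P): TRANSFER OF THE LEAD'S PRESENTATION RECORD `PresBy` (res-L1-w43-stub-2 g5, (P2) for the landed assembly)

Sub-problem `ResolutionOfSingularities`, ENGINE crux `stmt-ResolutionOfSingularities-8899` (`LocalWeightedDrop`), inner tame loop at
`m + 1 = 3`, S-ASM by regimes; the lead's assembly `regimePresented_of_pieces` (…NCResRegimePresentedAssembly, res-L1-w43-lead-1 g5) consumes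
its pieces through the record `Decoration.PresBy δ d A N Θ` (…NCResPresentationDefs): point-B-permissible `Θ`, history letters on the `y`-axis,
the other boundary letters on EXACTLY the `u`-axes `N ⊆ Fin 2`, `Θ^*(f·∏_O x_l) = U · monicGerm d A`.  This file moves that record along the
three manoeuvres of the decorated step:
* `Decoration.PresBy.of_strIdx_eq` — a re-presentation with the same straightening indices on the boundary presents with the same `N`;
  hence `Decoration.PresBy.shear` (the shear `u₂ ↦ u₂ + u₁h` off the conflict, `1 ∉ N`; …StepGraph `presentation_shear`) and
  `Decoration.PresBy.recentre` (the re-centring `y ↦ y + φ(u)` when there is no history, `O = ∅`; …StepPoint `presentation_recentre`);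
* `Decoration.PresBy.head_transform_eq_of_not_lt` — at a near answer (`γ = 0`) the history passes: no order drop ⇒ same head;
* `Decoration.PresBy.transform_zero` / `transform_zero_of_eq_zero` / `transform_zero_of_ne_zero` — THE SUCCESSOR AT A `u₁`-SLOT, same head,
  re-presented with DIAGONAL axes (…PresentedSuccAxes): boundary `insert 0 (N.filter (· = 1))` when the point has `c₁ = 0` (the `u₂`-letter
  passes), `{0}` when `c₁ ≠ 0`;
* `Decoration.PresBy.transform_one` — THE SUCCESSOR AT A `u₂`-SLOT (`c₀ = 0`), SWAPPED axes: boundary `insert 1 (N.filter (· = 0))`.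
The index arithmetic is that of `Fin 3`/`Fin 4` (`decide`).

All statements are ours (engine bookkeeping); nothing here is a statement of [CJS] or [CP-char2].
-/

set_option linter.dupNamespace false -- mandated namespace of this single-conjunct summit

noncomputable section

namespace Summit.ResolutionOfSingularities.ResolutionOfSingularities.Theorems

namespace TameFourTupleDrop

open MvPowerSeries Literature.AlgebraicGeometry.Resolution

variable {k : Type} [Field k]

/-! ## Small index facts in three letters -/

/-- `predAbove 0 (succ s) = y` iff `s = y`; `predAbove 0 (succ u₂) = x₁`. -/
theorem predAbove_zero_succ_eq_last_iff (s : Fin (2 + 1)) :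
    Fin.predAbove (0 : Fin (2 + 1)) (Fin.succ s) = Fin.last 2 ↔ s = Fin.last 2 := by
  revert s; decide

/-- At a `u`-slot: `predAbove i₀ (succ s) = y` iff `s = y`. -/
theorem predAbove_castSucc_succ_eq_last_iff (i₀ : Fin 2) (s : Fin (2 + 1)) :
    Fin.predAbove (Fin.castSucc i₀) (Fin.succ s) = Fin.last 2 ↔ s = Fin.last 2 := by
  revert i₀ s; decide

/-- Through the `u₁`-slot the `u₂`-letter keeps the index `x₁`. -/
theorem predAbove_zero_succ_one : Fin.predAbove (Fin.castSucc (0 : Fin 2)) (Fin.succ (Fin.castSucc (1 : Fin 2))) = Fin.castSucc 1 := by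
  decide

/-- Through the `u₂`-slot the `u₁`-letter gets the index `x₁`. -/
theorem predAbove_one_succ_zero : Fin.predAbove (Fin.castSucc (1 : Fin 2)) (Fin.succ (Fin.castSucc (0 : Fin 2))) = Fin.castSucc 1 := by
  decide

section Represent

variable {δ : Decoration k 2} {d : ℕ} {A B : Fin d → MvPowerSeries (Fin 2) k} {N : Finset (Fin 2)}
  {Θ Θ'' : Fin (2 + 1) → MvPowerSeries (Fin (2 + 1)) k} {U'' : MvPowerSeries (Fin (2 + 1)) k}

/-- **A RE-PRESENTATION WITH THE SAME STRAIGHTENING INDICES PRESENTS WITH THE SAME BOUNDARY.** -/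
theorem Decoration.PresBy.of_strIdx_eq (h : δ.PresBy d A N Θ) (hperm'' : IsBPermissible δ Θ'' (fun _ => 1))
    (hidx : ∀ l ∈ δ.E, strIdx Θ'' l = strIdx Θ l) (hU'' : constantCoeff U'' ≠ 0)
    (hP'' : subst Θ'' (δ.f * ∏ l ∈ δ.O, X l) = U'' * NCPoly.monicGerm d B) : δ.PresBy d B N Θ'' := by
  obtain ⟨-, hO, hE, hN, -⟩ := h
  refine ⟨hperm'', fun l hl => ?_, fun l hl hlO => ?_, fun j hj => ?_, U'', hU'', hP''⟩
  · rw [hidx l (δ.O_subset hl)]; exact hO l hl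
  · rw [hidx l hl]; exact hE l hl hlO
  · obtain ⟨l, hl, hlO, hs⟩ := hN j hj
    exact ⟨l, hl, hlO, by rw [hidx l hl]; exact hs⟩

/-- The unit and the equation of a presentation record. -/
theorem Decoration.PresBy.exists_eq (h : δ.PresBy d A N Θ) :
    ∃ U : MvPowerSeries (Fin (2 + 1)) k, constantCoeff U ≠ 0 ∧ subst Θ (δ.f * ∏ l ∈ δ.O, X l) = U * NCPoly.monicGerm d A :=
  h.2.2.2.2

/-- **OFF THE CONFLICT NO BOUNDARY LETTER IS ON THE `u₂`-AXIS**: with `1 ∉ N`, every boundary letter is straightened to `u₁` or `y`. -/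
theorem Decoration.PresBy.strIdx_ne_one (h : δ.PresBy d A N Θ) (h1N : (1 : Fin 2) ∉ N) :
    ∀ l ∈ δ.E, strIdx Θ l ≠ Fin.castSucc 1 := by
  classical
  intro l hl h1
  by_cases hlO : l ∈ δ.O
  · have := h.2.1 l hlO
    rw [h1] at this
    exact absurd this (by decide)
  · obtain ⟨j, hj, hs⟩ := h.2.2.1 l hl hlO
    rw [hs] at h1
    have hj1 : j = 1 := Fin.castSucc_injective _ h1
    exact h1N (hj1 ▸ hj)

/-- **WITHOUT HISTORY NO BOUNDARY LETTER IS ON THE `y`-AXIS**: with `O = ∅`, every boundary letter is straightened to a `u`-axis. -/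
theorem Decoration.PresBy.strIdx_ne_last (h : δ.PresBy d A N Θ) (hO : δ.O = ∅) :
    ∀ l ∈ δ.E, strIdx Θ l ≠ Fin.last 2 := by
  intro l hl hlast
  have hlO : l ∉ δ.O := by rw [hO]; exact Finset.notMem_empty l
  obtain ⟨j, -, hs⟩ := h.2.2.1 l hl hlO
  rw [hs] at hlast
  exact (Fin.castSucc_lt_last j).ne hlast

/-- **THE SHEAR KEEPS THE RECORD** (off the conflict): `PresBy δ d A N Θ`, `1 ∉ N` ⇒ `PresBy δ d (shearT h A) N Θ''` for some `Θ''`. -/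
theorem Decoration.PresBy.shear (h : δ.PresBy d A N Θ) (h1N : (1 : Fin 2) ∉ N) (g : MvPowerSeries (Fin 2) k) :
    ∃ Θ'' : Fin (2 + 1) → MvPowerSeries (Fin (2 + 1)) k, δ.PresBy d (PolyDescent.shearT g A) N Θ'' := by
  obtain ⟨U, hU, hP⟩ := h.exists_eq
  obtain ⟨Θ'', H'', hperm'', hidx, hH'', hP''⟩ := Decoration.presentation_shear h.1 (h.strIdx_ne_one h1N) hU hP g
  exact ⟨Θ'', h.of_strIdx_eq hperm'' hidx hH'' hP''⟩

/-- **THE RE-CENTRING KEEPS THE RECORD** (no history): `PresBy δ d L N Θ`, `O = ∅`, `φ(0) = 0` ⇒ `PresBy δ d (shift d L φ) N Θ''`. -/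
theorem Decoration.PresBy.recentre {L : Fin d → MvPowerSeries (Fin 2) k} {φ : MvPowerSeries (Fin 2) k} (h : δ.PresBy d L N Θ)
    (hO : δ.O = ∅) (hφ : constantCoeff φ = 0) :
    ∃ Θ'' : Fin (2 + 1) → MvPowerSeries (Fin (2 + 1)) k, δ.PresBy d (WildMonic.shift d L φ) N Θ'' := by
  classical
  obtain ⟨U, hU, hP⟩ := h.exists_eq
  obtain ⟨⟨hΘ0, hΘdet, -⟩, -, -, hP3⟩ := h.1
  have hny := h.strIdx_ne_last hO
  -- the re-centred coordinates, as in `presentation_recentre`, with their straightening indices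
  have hR0 : ∀ i, constantCoeff (NCPoly.recentre φ i) = 0 := NCPoly.constantCoeff_recentre hφ
  have hRs : HasSubst (NCPoly.recentre φ) := hasSubst_of_constantCoeff_zero hR0
  obtain ⟨Θ'', H'', hperm'', -, hH'', hP''⟩ := Decoration.presentation_recentre h.1 hny hU hP hφ
  -- we re-derive the indices from an explicit candidate: the lemma's `Θ''` is abstract, so use `of_strIdx_eq` on a concrete one
  set Θc : Fin (2 + 1) → MvPowerSeries (Fin (2 + 1)) k := fun i => subst (NCPoly.recentre φ) (Θ i) with hΘc
  have hstr : ∀ l ∈ δ.E, ∃ u : MvPowerSeries (Fin (2 + 1)) k, constantCoeff u ≠ 0 ∧ Θc l = u * X (strIdx Θ l) := by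
    intro l hl
    obtain ⟨u, hu, hul⟩ := strIdx_spec (hP3 l hl)
    obtain ⟨j, hj⟩ : ∃ j : Fin 2, strIdx Θ l = Fin.castSucc j := by
      rcases Fin.eq_castSucc_or_eq_last (strIdx Θ l) with ⟨j, hj⟩ | hlast
      · exact ⟨j, hj⟩
      · exact absurd hlast (hny l hl)
    refine ⟨subst (NCPoly.recentre φ) u, by rwa [WildTerminal.constantCoeff_subst_of_constantCoeff_zero hR0], ?_⟩
    simp only [hΘc]
    rw [hul, hj, ← coe_substAlgHom hRs, map_mul, coe_substAlgHom, subst_X hRs,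
      NCPoly.recentre_of_ne φ (Fin.castSucc_lt_last j).ne]
  have hΘc0 : ∀ i, constantCoeff (Θc i) = 0 := fun i =>
    constantCoeff_subst_eq_zero hRs hR0 (hΘ0 i)
  have hΘcdet : IsUnit (FormalCoordChange.linMat Θc).det := by
    have hlin : FormalCoordChange.linMat Θc = FormalCoordChange.linMat Θ * FormalCoordChange.linMat (NCPoly.recentre φ) := by
      ext i j
      simp only [FormalCoordChange.linMat, Matrix.of_apply, Matrix.mul_apply, hΘc]
      exact CobordantArc.coeff_degree_one_subst _ hR0 (Θ i) _ (Finsupp.degree_single _ _)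
    rw [hlin, Matrix.det_mul]
    exact hΘdet.mul (NCPoly.isUnit_det_linMat_recentre φ)
  have hP3c : ∀ l ∈ δ.E, ∃ (l' : Fin (2 + 1)) (u : MvPowerSeries (Fin (2 + 1)) k), constantCoeff u ≠ 0 ∧ Θc l = u * X l' :=
    fun l hl => by obtain ⟨u, hu, h⟩ := hstr l hl; exact ⟨_, u, hu, h⟩
  have hmvc : IsCountMove Θc (fun _ => 1) := ⟨hΘc0, hΘcdet, fun _ => le_rfl, ⟨0, Nat.one_pos⟩⟩
  have hPc : subst Θc (δ.f * ∏ l ∈ δ.O, X l) = subst (NCPoly.recentre φ) U * NCPoly.monicGerm d (WildMonic.shift d L φ) := by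
    rw [hΘc, ← subst_comp_subst_apply (hasSubst_of_constantCoeff_zero hΘ0) hRs, hP, ← coe_substAlgHom hRs, map_mul,
      coe_substAlgHom, NCPoly.subst_recentre_monicGerm hφ]
  refine ⟨Θc, h.of_strIdx_eq (isBPermissible_point hmvc hP3c) (fun l hl => ?_)
    (by rwa [WildTerminal.constantCoeff_subst_of_constantCoeff_zero hR0]) hPc⟩
  obtain ⟨u, hu, h⟩ := hstr l hl
  exact strIdx_eq_of_eq_unit_mul_X hu h

/-- **AT A NEAR ANSWER OF A RECORDED STATE, NO ORDER DROP MEANS THE SAME HEAD**: the history letters are on the `y`-axis (`PresBy`), so at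
`γ = 0` they all pass; their number is kept, and with the order letter so is the head. -/
theorem Decoration.PresBy.head_transform_eq_of_not_lt (h : δ.PresBy d A N Θ) {w : Fin (2 + 1) → ℕ} {pt : Fin (2 + 1) → k}
    {i : Fin (2 + 1)} (hpermw : IsBPermissible δ Θ w) (hconv : ∀ l, w l = 0 → pt l = 0) (hf : δ.f ≠ 0) (hci : pt i ≠ 0)
    (hγ : pt (Fin.last 2) = 0) (hnot : ¬ (δ.transform Θ w pt i).o < δ.o) : (δ.transform Θ w pt i).head = δ.head := by
  classical
  have ho : (δ.transform Θ w pt i).o = δ.o := le_antisymm (Decoration.o_transform_le hpermw hconv hf hci) (not_lt.mp hnot)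
  have hO' : (δ.transform Θ w pt i).O = Decoration.newLetters δ.O Θ pt i := by
    refine Decoration.transform_O_of_not_lt _ _ _ _ _ ?_
    rw [← Decoration.transform_o]; exact hnot
  have hcard : (δ.transform Θ w pt i).O.card = δ.O.card := by
    rw [hO']
    unfold Decoration.newLetters
    rw [Finset.filter_true_of_mem fun l hl => by rw [h.2.1 l hl]; exact hγ]
    exact Finset.card_image_of_injOn fun l₁ h₁ l₂ h₂ _ =>
      strIdx_injOn h.1 (δ.O_subset h₁) (δ.O_subset h₂) (by rw [h.2.1 l₁ h₁, h.2.1 l₂ h₂])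
  have hc : (δ.transform Θ w pt i).c = δ.c := by rw [Decoration.c, Decoration.c, ho, hcard]
  unfold Decoration.head
  rw [ho, hc]

end Represent

section Transform

variable {δ : Decoration k 2} {d : ℕ} {A A' : Fin d → MvPowerSeries (Fin 2) k} {N : Finset (Fin 2)}
  {Φ₀ Θ' : Fin (2 + 1) → MvPowerSeries (Fin (2 + 1)) k} {w : Fin (2 + 1) → ℕ} {pt : Fin (2 + 1) → k} {γ₁ : k}
  {U' : MvPowerSeries (Fin (2 + 1)) k}

/-- **THE RECORD OF A SAME-HEAD SUCCESSOR AT THE `u₁`-SLOT** (diagonal new coordinates), with the successor boundary described by membership: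
`j ∈ N′ ↔ j = 0 ∨ (j = 1 ∧ 1 ∈ N ∧ c₁ = 0)`. -/
theorem Decoration.PresBy.transform_zero (h : δ.PresBy d A N Φ₀)
    (hhead : (δ.transform Φ₀ w pt (Fin.castSucc 0)).head = δ.head) (hc0 : pt (Fin.castSucc 0) ≠ 0)
    (hperm' : IsBPermissible (δ.transform Φ₀ w pt (Fin.castSucc 0)) Θ' (fun _ => 1))
    (hax : ∀ i : Fin 2, ∃ a : k, a ≠ 0 ∧ Θ' (Fin.castSucc i) = C a * X (Fin.castSucc i))
    (hΘ'l : Θ' (Fin.last 2) = C γ₁ * X (Fin.last 2)) (hγ₁ : γ₁ ≠ 0) (hU' : constantCoeff U' ≠ 0)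
    (hP' : subst Θ' ((δ.transform Φ₀ w pt (Fin.castSucc 0)).f * ∏ l ∈ (δ.transform Φ₀ w pt (Fin.castSucc 0)).O, X l) =
      U' * NCPoly.monicGerm d A')
    {N' : Finset (Fin 2)} (hN' : ∀ j, j ∈ N' ↔ j = 0 ∨ (j = 1 ∧ (1 : Fin 2) ∈ N ∧ pt (Fin.castSucc 1) = 0)) :
    (δ.transform Φ₀ w pt (Fin.castSucc 0)).PresBy d A' N' Θ' := by
  classical
  obtain ⟨hpermΦ, hO, hE, hN, -⟩ := h
  have hO' := Decoration.O_transform_eq_of_head_eq' hhead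
  have hE' := Decoration.transform_E δ Φ₀ w pt (Fin.castSucc 0)
  have hax' : ∀ i : Fin 2, strIdx Θ' (Fin.castSucc i) = Fin.castSucc i := fun i => by
    obtain ⟨a, ha, hi⟩ := hax i
    exact strIdx_eq_of_eq_unit_mul_X (u := C a) (by rwa [constantCoeff_C]) hi
  have hlast' : strIdx Θ' (Fin.last 2) = Fin.last 2 :=
    strIdx_eq_of_eq_unit_mul_X (u := C γ₁) (by rwa [constantCoeff_C]) hΘ'l
  -- through-going old letters sit on `y`
  have hOidx : ∀ l' ∈ (δ.transform Φ₀ w pt (Fin.castSucc 0)).O, l' = Fin.last 2 := by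
    intro l' hl'
    rw [hO'] at hl'
    unfold Decoration.newLetters at hl'
    obtain ⟨l, hl, rfl⟩ := Finset.mem_image.mp hl'
    rw [(predAbove_castSucc_succ_eq_last_iff 0 _).mpr (hO l (Finset.mem_filter.mp hl).1)]
  refine ⟨hperm', fun l' hl' => by rw [hOidx l' hl', hlast'], fun l' hl' hl'O => ?_, fun j hj => ?_, U', hU', hP'⟩
  · -- new letters: the exceptional one is on `u₁`, a through-going one comes from the `u₂`-axis
    rw [hE', Finset.mem_insert] at hl'
    rcases hl' with rfl | hnew
    · exact ⟨0, (hN' 0).mpr (Or.inl rfl), hax' 0⟩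
    · have hnew' := hnew
      unfold Decoration.newLetters at hnew
      obtain ⟨l, hl, hll'⟩ := Finset.mem_image.mp hnew
      obtain ⟨hlE, hpt⟩ := Finset.mem_filter.mp hl
      have hlO : l ∉ δ.O := by
        intro hlO
        apply hl'O
        rw [hO']
        unfold Decoration.newLetters
        exact Finset.mem_image.mpr ⟨l, Finset.mem_filter.mpr ⟨hlO, hpt⟩, hll'⟩
      obtain ⟨j, hj, hs⟩ := hE l hlE hlO
      have hj1 : j = 1 := by
        rcases Fin.eq_zero_or_eq_succ j with rfl | ⟨j', rfl⟩
        · rw [hs] at hpt; exact absurd hpt hc0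
        · exact congrArg Fin.succ (Fin.eq_zero j') ▸ rfl
      subst hj1
      rw [hs] at hpt hll'
      rw [predAbove_zero_succ_one] at hll'
      subst hll'
      exact ⟨1, (hN' 1).mpr (Or.inr ⟨rfl, hj, hpt⟩), hax' 1⟩
  · rcases (hN' j).mp hj with rfl | ⟨rfl, h1N, hpt1⟩
    · refine ⟨0, by rw [hE']; exact Finset.mem_insert_self _ _, ?_, hax' 0⟩
      rw [hO']
      exact Decoration.zero_notMem_newLetters _ _ _ hc0
    · obtain ⟨l, hlE, hlO, hs⟩ := hN 1 h1N
      have hmem : Fin.castSucc (1 : Fin 2) ∈ Decoration.newLetters δ.E Φ₀ pt (Fin.castSucc 0) := by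
        unfold Decoration.newLetters
        refine Finset.mem_image.mpr ⟨l, Finset.mem_filter.mpr ⟨hlE, by rw [hs]; exact hpt1⟩, ?_⟩
        rw [hs, predAbove_zero_succ_one]
      refine ⟨Fin.castSucc 1, by rw [hE']; exact Finset.mem_insert_of_mem hmem, fun hO1 => ?_, hax' 1⟩
      exact absurd (hOidx _ hO1) (by decide)

/-- The `u₁`-slot successor when the `u₂`-coordinate of the point vanishes: boundary `insert 0 (N.filter (· = 1))`. -/
theorem Decoration.PresBy.transform_zero_of_eq_zero (h : δ.PresBy d A N Φ₀)
    (hhead : (δ.transform Φ₀ w pt (Fin.castSucc 0)).head = δ.head) (hc0 : pt (Fin.castSucc 0) ≠ 0) (hc1 : pt (Fin.castSucc 1) = 0)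
    (hperm' : IsBPermissible (δ.transform Φ₀ w pt (Fin.castSucc 0)) Θ' (fun _ => 1))
    (hax : ∀ i : Fin 2, ∃ a : k, a ≠ 0 ∧ Θ' (Fin.castSucc i) = C a * X (Fin.castSucc i))
    (hΘ'l : Θ' (Fin.last 2) = C γ₁ * X (Fin.last 2)) (hγ₁ : γ₁ ≠ 0) (hU' : constantCoeff U' ≠ 0)
    (hP' : subst Θ' ((δ.transform Φ₀ w pt (Fin.castSucc 0)).f * ∏ l ∈ (δ.transform Φ₀ w pt (Fin.castSucc 0)).O, X l) =
      U' * NCPoly.monicGerm d A') :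
    (δ.transform Φ₀ w pt (Fin.castSucc 0)).PresBy d A' (insert 0 (N.filter fun l => l = 1)) Θ' :=
  h.transform_zero hhead hc0 hperm' hax hΘ'l hγ₁ hU' hP' fun j => by
    rw [Finset.mem_insert, Finset.mem_filter]
    constructor
    · rintro (rfl | ⟨hj, rfl⟩)
      · exact Or.inl rfl
      · exact Or.inr ⟨rfl, hj, hc1⟩
    · rintro (rfl | ⟨rfl, hj, -⟩)
      · exact Or.inl rfl
      · exact Or.inr ⟨hj, rfl⟩

/-- The `u₁`-slot successor when the `u₂`-coordinate of the point is nonzero: boundary `{0}`. -/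
theorem Decoration.PresBy.transform_zero_of_ne_zero (h : δ.PresBy d A N Φ₀)
    (hhead : (δ.transform Φ₀ w pt (Fin.castSucc 0)).head = δ.head) (hc0 : pt (Fin.castSucc 0) ≠ 0) (hc1 : pt (Fin.castSucc 1) ≠ 0)
    (hperm' : IsBPermissible (δ.transform Φ₀ w pt (Fin.castSucc 0)) Θ' (fun _ => 1))
    (hax : ∀ i : Fin 2, ∃ a : k, a ≠ 0 ∧ Θ' (Fin.castSucc i) = C a * X (Fin.castSucc i))
    (hΘ'l : Θ' (Fin.last 2) = C γ₁ * X (Fin.last 2)) (hγ₁ : γ₁ ≠ 0) (hU' : constantCoeff U' ≠ 0)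
    (hP' : subst Θ' ((δ.transform Φ₀ w pt (Fin.castSucc 0)).f * ∏ l ∈ (δ.transform Φ₀ w pt (Fin.castSucc 0)).O, X l) =
      U' * NCPoly.monicGerm d A') :
    (δ.transform Φ₀ w pt (Fin.castSucc 0)).PresBy d A' {0} Θ' :=
  h.transform_zero hhead hc0 hperm' hax hΘ'l hγ₁ hU' hP' fun j => by
    rw [Finset.mem_singleton]
    constructor
    · intro hj; exact Or.inl hj
    · rintro (hj | ⟨-, -, h0⟩)
      · exact hj
      · exact absurd h0 hc1

/-- **THE RECORD OF A SAME-HEAD SUCCESSOR AT THE `u₂`-SLOT** (`c₀ = 0`; swapped new coordinates: the exceptional letter is the `u₂`-axis of the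
label, the passing `u₁`-letter is on `u₁`): boundary `insert 1 (N.filter (· = 0))`. -/
theorem Decoration.PresBy.transform_one (h : δ.PresBy d A N Φ₀)
    (hhead : (δ.transform Φ₀ w pt (Fin.castSucc 1)).head = δ.head) (hc1 : pt (Fin.castSucc 1) ≠ 0) (hc0 : pt (Fin.castSucc 0) = 0)
    (hperm' : IsBPermissible (δ.transform Φ₀ w pt (Fin.castSucc 1)) Θ' (fun _ => 1))
    (hax : ∀ i : Fin 2, ∃ a : k, a ≠ 0 ∧ Θ' (Fin.castSucc i) = C a * X (Fin.castSucc (Equiv.swap (0 : Fin 2) 1 i)))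
    (hΘ'l : Θ' (Fin.last 2) = C γ₁ * X (Fin.last 2)) (hγ₁ : γ₁ ≠ 0) (hU' : constantCoeff U' ≠ 0)
    (hP' : subst Θ' ((δ.transform Φ₀ w pt (Fin.castSucc 1)).f * ∏ l ∈ (δ.transform Φ₀ w pt (Fin.castSucc 1)).O, X l) =
      U' * NCPoly.monicGerm d A') :
    (δ.transform Φ₀ w pt (Fin.castSucc 1)).PresBy d A' (insert 1 (N.filter fun l => l = 0)) Θ' := by
  classical
  obtain ⟨hpermΦ, hO, hE, hN, -⟩ := h
  have hO' := Decoration.O_transform_eq_of_head_eq' hhead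
  have hE' := Decoration.transform_E δ Φ₀ w pt (Fin.castSucc 1)
  have hax' : ∀ i : Fin 2, strIdx Θ' (Fin.castSucc i) = Fin.castSucc (Equiv.swap (0 : Fin 2) 1 i) := fun i => by
    obtain ⟨a, ha, hi⟩ := hax i
    exact strIdx_eq_of_eq_unit_mul_X (u := C a) (by rwa [constantCoeff_C]) hi
  have hax0 : strIdx Θ' 0 = Fin.castSucc 1 := by
    have := hax' 0; rwa [Equiv.swap_apply_left] at this
  have hax1 : strIdx Θ' (Fin.castSucc 1) = Fin.castSucc 0 := by
    have := hax' 1; rwa [Equiv.swap_apply_right] at this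
  have hlast' : strIdx Θ' (Fin.last 2) = Fin.last 2 :=
    strIdx_eq_of_eq_unit_mul_X (u := C γ₁) (by rwa [constantCoeff_C]) hΘ'l
  have hOidx : ∀ l' ∈ (δ.transform Φ₀ w pt (Fin.castSucc 1)).O, l' = Fin.last 2 := by
    intro l' hl'
    rw [hO'] at hl'
    unfold Decoration.newLetters at hl'
    obtain ⟨l, hl, rfl⟩ := Finset.mem_image.mp hl'
    rw [(predAbove_castSucc_succ_eq_last_iff 1 _).mpr (hO l (Finset.mem_filter.mp hl).1)]
  refine ⟨hperm', fun l' hl' => by rw [hOidx l' hl', hlast'], fun l' hl' hl'O => ?_, fun j hj => ?_, U', hU', hP'⟩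
  · rw [hE', Finset.mem_insert] at hl'
    rcases hl' with rfl | hnew
    · exact ⟨1, Finset.mem_insert_self _ _, hax0⟩
    · unfold Decoration.newLetters at hnew
      obtain ⟨l, hl, hll'⟩ := Finset.mem_image.mp hnew
      obtain ⟨hlE, hpt⟩ := Finset.mem_filter.mp hl
      have hlO : l ∉ δ.O := by
        intro hlO
        apply hl'O
        rw [hO']
        unfold Decoration.newLetters
        exact Finset.mem_image.mpr ⟨l, Finset.mem_filter.mpr ⟨hlO, hpt⟩, hll'⟩
      obtain ⟨j, hj, hs⟩ := hE l hlE hlO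
      have hj0 : j = 0 := by
        rcases Fin.eq_zero_or_eq_succ j with rfl | ⟨j', rfl⟩
        · rfl
        · have hj1 : (Fin.succ j' : Fin 2) = 1 := congrArg Fin.succ (Fin.eq_zero j')
          rw [hj1] at hs
          rw [hs] at hpt
          exact absurd hpt hc1
      subst hj0
      rw [hs] at hll'
      rw [predAbove_one_succ_zero] at hll'
      subst hll'
      exact ⟨0, Finset.mem_insert_of_mem (Finset.mem_filter.mpr ⟨hj, rfl⟩), hax1⟩
  · rw [Finset.mem_insert, Finset.mem_filter] at hj
    rcases hj with rfl | ⟨h0N, rfl⟩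
    · refine ⟨0, by rw [hE']; exact Finset.mem_insert_self _ _, ?_, hax0⟩
      rw [hO']
      exact Decoration.zero_notMem_newLetters _ _ _ hc1
    · obtain ⟨l, hlE, hlO, hs⟩ := hN 0 h0N
      have hmem : Fin.castSucc (1 : Fin 2) ∈ Decoration.newLetters δ.E Φ₀ pt (Fin.castSucc 1) := by
        unfold Decoration.newLetters
        refine Finset.mem_image.mpr ⟨l, Finset.mem_filter.mpr ⟨hlE, by rw [hs]; exact hc0⟩, ?_⟩
        rw [hs, predAbove_one_succ_zero]
      refine ⟨Fin.castSucc 1, by rw [hE']; exact Finset.mem_insert_of_mem hmem, fun hO1 => ?_, hax1⟩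
      exact absurd (hOidx _ hO1) (by decide)

end Transform

end TameFourTupleDrop

end Summit.ResolutionOfSingularities.ResolutionOfSingularities.Theorems

end
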